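import Summits.CriticalPhenomena.CardyFormulaZ2.Theorems.CardyBoundaryCoulombGasStripClusterRatesReduction
import Summits.CriticalPhenomena.CardyFormulaZ2.Theorems.CardyBoundaryCoulombGasStripClusterRatesStubBetheGroundExists
import Summits.CriticalPhenomena.CardyFormulaZ2.Theorems.CardyBoundaryCoulombGasStripClusterRatesBetheKernelToolkit
import Summits.CriticalPhenomena.CardyFormulaZ2.Theorems.CardyBoundaryCoulombGasStripClusterRatesModulusUnique
import Summits.CriticalPhenomena.CardyFormulaZ2.Theorems.CardyBoundaryCoulombGasStripClusterRatesEscapeOfPositiveVector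

/-!
# `StripClusterRates` from the Bethe-ansatz pillars (line `two-cluster-rate-is-stationary-gap`, reduction 2)

Crux `Summit.CriticalPhenomena.CardyFormulaZ2.Theses.CardyBoundaryCoulombGas.StripClusterRates`
(stmt-CriticalPhenomena-13878), continuation lead `prover-line-stmt-CriticalPhenomena-13878-c1-0`.

The first reduction (`…StripClusterRatesReduction`, `stripClusterRates_iff_kacGapAsymptotics`) made the crux
equivalent to the Kac gap asymptotics of the planar `⋆`-chain `planarTransfer (Finset.Icc 0 n)`:
`n·(-log ρ_marked(n)) → π/3` and `n·(-log SLEM_unmarked(n)) → 2π`.  Both moduli have an exact Bethe-ansatz form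
(Yung–Batchelor 1995: Sklyanin's open double-row transfer matrix with alternating inhomogeneities is the axis
transfer matrix with free boundaries; isotropic point `u = -λ/2`, `γ = π/3`, `N = 2n+2` strands): with
`F(w) = arctan((2+√3) tanh w) + arctan(tanh w)`, `G(x) = arctan(tanh x/√3)`, `f(w) = (4sinh²w+2)/(4sinh²w+2-√3)`,
the ground state of the sector with `M` roots solves `N·F(w_j) - Σ_{l≠j}[G(w_j-w_l) + G(w_j+w_l)] = π(j+1)`
(`0 < w_0 < ⋯ < w_{M-1}`) and has eigenvalue `Λ_n(w) = 2^{-(2n+1)} ∏ f(w_j)`; `M = n` is the marked block (escape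
modulus), `M = n - 1` gives the SLEM of the unmarked block (checked to 12 digits for `n ≤ 12`; Kac limits to 8 digits
at `n = 4096`).  This file proves, sorry-free, that the crux FOLLOWS from four explicit statements about this system —
the registered stubs of the line after wave 1:

* BP₁ positive Bethe eigenvector of the marked block with eigenvalue `Λ_n(w)` at every ground-state solution, `M = n`;
* BI₂ the relaxation modulus equals `Λ_n(w)` at every ground-state solution, `M = n - 1`;
* BA₁ `n·(-log Λ_n(w⁽ⁿ⁾)) → π/3` along every family of ground-state solutions with `M = n`;
* BA₂ `n·(-log Λ_n(w⁽ⁿ⁾)) → 2π` along every family with `M = n - 1`;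

using three LANDED ingredients: existence of ground-state solutions for `2M ≤ N` (`stub_betheGroundExists`,
variational proof), the Collatz–Wielandt step (`bi1_escapeModulus_of_positiveVector`) with uniqueness of the
escape modulus (`bi_escapeModulus_unique`) and `Λ_n(w) > 0` (`bk_betheLambda_pos`), and the first reduction.
BP₁/BI₂ are the algebraic-Bethe-ansatz + Perron-identification input (Sklyanin 1988, Yung–Batchelor 1995 §3),
BA₁/BA₂ the finite-size (conformal) analysis of the staggered open chain (Hamer–Quispel–Batchelor 1987 for the
homogeneous chain; no rigorous treatment in print) — together the open core of the crux. Everything is inlined over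
tree vocabulary; no definitions.
-/

noncomputable section

namespace Summit.CriticalPhenomena.CardyFormulaZ2.Cruxes.StripClusterRates.TwoClusterRateIsStationaryGap

open Filter Topology
open scoped BigOperators Classical
open Literature.Probability.Percolation Literature.Probability.LatticeModels

/-- **`StripClusterRates` from the four Bethe pillars** BP₁ (positive Bethe eigenvector of the marked block),
BI₂ (relaxation modulus = Bethe eigenvalue at `M = n-1`), BA₁, BA₂ (Kac asymptotics `π/3`, `2π` of the Bethe
eigenvalue along ground-state solutions).  Existence of the solutions, the Collatz–Wielandt identification of the
escape modulus and the reduction of the crux to gap asymptotics are landed theorems.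
[cite: YungBatchelor1995, §3] [cite: Cardy1998, eq. (bb)] -/
theorem stripClusterRates_of_bethePillars :
    (∀ n : ℕ, 1 ≤ n → ∀ w : Fin n → ℝ,
        (StrictMono w ∧ (∀ j, 0 < w j) ∧
          ∀ j : Fin n, ((2 * n + 2 : ℕ) : ℝ) *
              (Real.arctan ((2 + Real.sqrt 3) * Real.tanh (w j)) + Real.arctan (Real.tanh (w j))) -
            ∑ l ∈ Finset.univ.erase j,
              (Real.arctan (Real.tanh (w j - w l) / Real.sqrt 3) + Real.arctan (Real.tanh (w j + w l) / Real.sqrt 3)) =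
            Real.pi * ((j : ℕ) + 1)) →
        ∃ v : PlanarRowState (Finset.Icc (0 : ℤ) n) → ℝ,
          (∀ p, (∃ x, p.1.JoinedToStar x) → 0 < v p) ∧ (∀ p, (∀ x, ¬ p.1.JoinedToStar x) → v p = 0) ∧
            ∀ p, (∃ x, p.1.JoinedToStar x) →
              ∑ q, planarTransfer (Finset.Icc (0 : ℤ) n) p q * v q =
                (∏ j, (4 * Real.sinh (w j) ^ 2 + 2) / (4 * Real.sinh (w j) ^ 2 + 2 - Real.sqrt 3)) / 2 ^ (2 * n + 1) *
                  v p) →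
    (∀ n : ℕ, 1 ≤ n → ∀ s : ℝ,
        ((∃ (μ : ℂ) (v : PlanarRowState (Finset.Icc (0 : ℤ) n) → ℂ),
            (v ≠ 0 ∧ (∀ p, (∃ x, p.1.JoinedToStar x) → v p = 0) ∧
              ∀ p, (∀ x, ¬ p.1.JoinedToStar x) →
                ∑ q, (planarTransfer (Finset.Icc (0 : ℤ) n) p q : ℂ) * v q = μ * v p) ∧
            μ ≠ 1 ∧ ‖μ‖ = s) ∧
          ∀ (μ : ℂ) (v : PlanarRowState (Finset.Icc (0 : ℤ) n) → ℂ),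
            (v ≠ 0 ∧ (∀ p, (∃ x, p.1.JoinedToStar x) → v p = 0) ∧
              ∀ p, (∀ x, ¬ p.1.JoinedToStar x) →
                ∑ q, (planarTransfer (Finset.Icc (0 : ℤ) n) p q : ℂ) * v q = μ * v p) →
            μ ≠ 1 → ‖μ‖ ≤ s) →
        ∀ w : Fin (n - 1) → ℝ,
          (StrictMono w ∧ (∀ j, 0 < w j) ∧
            ∀ j : Fin (n - 1), ((2 * n + 2 : ℕ) : ℝ) *
                (Real.arctan ((2 + Real.sqrt 3) * Real.tanh (w j)) + Real.arctan (Real.tanh (w j))) -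
              ∑ l ∈ Finset.univ.erase j,
                (Real.arctan (Real.tanh (w j - w l) / Real.sqrt 3) + Real.arctan (Real.tanh (w j + w l) / Real.sqrt 3)) =
              Real.pi * ((j : ℕ) + 1)) →
          s = (∏ j, (4 * Real.sinh (w j) ^ 2 + 2) / (4 * Real.sinh (w j) ^ 2 + 2 - Real.sqrt 3)) / 2 ^ (2 * n + 1)) →
    (∀ w : (n : ℕ) → (Fin n → ℝ),
        (∀ n : ℕ, 1 ≤ n →
          StrictMono (w n) ∧ (∀ j, 0 < w n j) ∧
            ∀ j : Fin n, ((2 * n + 2 : ℕ) : ℝ) *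
                (Real.arctan ((2 + Real.sqrt 3) * Real.tanh (w n j)) + Real.arctan (Real.tanh (w n j))) -
              ∑ l ∈ Finset.univ.erase j,
                (Real.arctan (Real.tanh (w n j - w n l) / Real.sqrt 3) +
                  Real.arctan (Real.tanh (w n j + w n l) / Real.sqrt 3)) =
              Real.pi * ((j : ℕ) + 1)) →
        Tendsto (fun n : ℕ ↦ (n : ℝ) *
            -Real.log ((∏ j, (4 * Real.sinh (w n j) ^ 2 + 2) / (4 * Real.sinh (w n j) ^ 2 + 2 - Real.sqrt 3)) /
              2 ^ (2 * n + 1))) atTop (𝓝 (Real.pi / 3))) →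
    (∀ w : (n : ℕ) → (Fin (n - 1) → ℝ),
        (∀ n : ℕ, 1 ≤ n →
          StrictMono (w n) ∧ (∀ j, 0 < w n j) ∧
            ∀ j : Fin (n - 1), ((2 * n + 2 : ℕ) : ℝ) *
                (Real.arctan ((2 + Real.sqrt 3) * Real.tanh (w n j)) + Real.arctan (Real.tanh (w n j))) -
              ∑ l ∈ Finset.univ.erase j,
                (Real.arctan (Real.tanh (w n j - w n l) / Real.sqrt 3) +
                  Real.arctan (Real.tanh (w n j + w n l) / Real.sqrt 3)) =
              Real.pi * ((j : ℕ) + 1)) →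
        Tendsto (fun n : ℕ ↦ (n : ℝ) *
            -Real.log ((∏ j, (4 * Real.sinh (w n j) ^ 2 + 2) / (4 * Real.sinh (w n j) ^ 2 + 2 - Real.sqrt 3)) /
              2 ^ (2 * n + 1))) atTop (𝓝 (2 * Real.pi))) →
    Summit.CriticalPhenomena.CardyFormulaZ2.Theses.CardyBoundaryCoulombGas.StripClusterRates := by
  intro hP hI₂ hA₁ hA₂
  apply stripClusterRates_of_kacGapAsymptotics
  constructor
  · intro r hr
    have hex : ∀ n : ℕ, ∃ w : Fin n → ℝ, StrictMono w ∧ (∀ j, 0 < w j) ∧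
        ∀ j : Fin n, ((2 * n + 2 : ℕ) : ℝ) *
            (Real.arctan ((2 + Real.sqrt 3) * Real.tanh (w j)) + Real.arctan (Real.tanh (w j))) -
          ∑ l ∈ Finset.univ.erase j,
            (Real.arctan (Real.tanh (w j - w l) / Real.sqrt 3) + Real.arctan (Real.tanh (w j + w l) / Real.sqrt 3)) =
          Real.pi * ((j : ℕ) + 1) :=
      fun n => stub_betheGroundExists (2 * n + 2) n (by omega)
    choose w hw using hex
    refine (hA₁ w fun n _ => hw n).congr' ?_
    filter_upwards [eventually_ge_atTop 1] with n hn
    obtain ⟨v, hvpos, hvzero, hveig⟩ := hP n hn (w n) (hw n)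
    rw [bi_escapeModulus_unique n (r n) _ (hr n hn)
      (bi1_escapeModulus_of_positiveVector n _ v (bk_betheLambda_pos n (w n)) hvpos hvzero hveig)]
  · intro s hs
    have hex : ∀ n : ℕ, ∃ w : Fin (n - 1) → ℝ, StrictMono w ∧ (∀ j, 0 < w j) ∧
        ∀ j : Fin (n - 1), ((2 * n + 2 : ℕ) : ℝ) *
            (Real.arctan ((2 + Real.sqrt 3) * Real.tanh (w j)) + Real.arctan (Real.tanh (w j))) -
          ∑ l ∈ Finset.univ.erase j,
            (Real.arctan (Real.tanh (w j - w l) / Real.sqrt 3) + Real.arctan (Real.tanh (w j + w l) / Real.sqrt 3)) =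
          Real.pi * ((j : ℕ) + 1) :=
      fun n => stub_betheGroundExists (2 * n + 2) (n - 1) (by omega)
    choose w hw using hex
    refine (hA₂ w fun n _ => hw n).congr' ?_
    filter_upwards [eventually_ge_atTop 1] with n hn
    rw [hI₂ n hn (s n) (hs n hn) (w n) (hw n)]

end Summit.CriticalPhenomena.CardyFormulaZ2.Cruxes.StripClusterRates.TwoClusterRateIsStationaryGap

end
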